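import Summits.NavierStokesRegularity.NavierStokesRegularity.Theorems.RootDecompLiouvilleHorizonLadderTop
import HarnessLib

/-!
# Route `RootDecompLiouvilleHorizon` (N22): B♯ `RecordZoomBridge` (item stmt-NavierStokesRegularity-32032) — closing link

The proof is `Theorems.RootDecompLiouvilleHorizonLadderTop.recordZoomBridge_proof` (lens-5 g22 «LADDER TOP»,
landed with the top rung's workitem stmt-NavierStokesRegularity-32322; one proposal carries one `--workitem`);
this file is the by-name closing link for B♯'s item: the record-zoom bridge follows from the PROVED
compactness item CPT `HorizonCompactness` (stmt-NavierStokesRegularity-32320,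
`Theorems.RootDecompLiouvilleHorizonHorizonCompactness.horizonCompactness_proof`).
-/

set_option linter.dupNamespace false

namespace Summit.NavierStokesRegularity.NavierStokesRegularity.Theorems.RootDecompLiouvilleHorizonRecordZoomBridge

/-- **B♯ `RecordZoomBridge`, item stmt-NavierStokesRegularity-32032**: PROVED unconditionally
(`RootDecompLiouvilleHorizonLadderTop.recordZoomBridge_proof` = `recordZoomBridge_of_horizonCompactness
horizonCompactness_proof`). [cite: KochNadirashviliSereginSverak2009, Thm 6.2] -/
theorem recordZoomBridge_holds :
    Summit.NavierStokesRegularity.NavierStokesRegularity.Theses.RootDecompLiouvilleHorizon.RecordZoomBridge :=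
  RootDecompLiouvilleHorizonLadderTop.recordZoomBridge_proof

end Summit.NavierStokesRegularity.NavierStokesRegularity.Theorems.RootDecompLiouvilleHorizonRecordZoomBridge
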